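import Literature.AlgebraicTopology.FundamentalGroupoid.GeneralPositionManifold
import HarnessLib

/-!
# The complement of a thin compact set in a simply connected open set is simply connected

Topic `Literature/AlgebraicTopology/FundamentalGroupoid`; a packaging of the general position
theorems of `GeneralPositionManifold.lean` (M. W. Hirsch, *Differential Topology* (1976), Ch. 3,
Thm. 2.5 and its standard corollary: a compact union of submanifolds of codimension `≥ 3` neither
disconnects nor obstructs null-homotopies; A. Kosinski, *Differential Manifolds* (1993), VI.2).
For a Hausdorff `C^∞` manifold `M` over a finite-dimensional model `E` and a compact set `C` of
interior points covered by countably many `C¹` images of open subsets of `ℝᵈ` with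
`d + 2 < dim E`:

* `Literature.AlgebraicTopology.FundamentalGroupoid.IsSimplyConnected.diff_thin` — if `U ⊆ M`
  is open and simply connected and `U ∖ C` is nonempty, then `U ∖ C` is simply connected
  (paths in `U` between points off `C` are pushed off `C`,
  `exists_path_forall_notMem_homotopicWithin`; null-homotopies in `U` of loops off `C` are pushed
  off `C`, `exists_homotopy_forall_notMem`).

For the `E₈` plumbing (Kosinski VI.12) this gives `π₁(M(4m) ∖ cores) = 1` from
`π₁(int M(4m)) = 1` (`TreeShapedUnionHomology.lean`), the eight core `2m`-spheres being thin of
codimension `2m ≥ 3`. Everything is proved; no definitions.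

## References

* M. W. Hirsch, *Differential Topology*, GTM 33, Springer (1976), Ch. 3, Thm. 2.5. [HirschDT1976]
* A. Kosinski, *Differential Manifolds*, Academic Press (1993), VI.2. [Kosinski1993]
-/

noncomputable section

open Set Metric Topology unitInterval Function Module Filter
open scoped Manifold ContDiff

namespace Literature.AlgebraicTopology.FundamentalGroupoid

variable {E : Type*} [NormedAddCommGroup E] [NormedSpace ℝ E] [FiniteDimensional ℝ E]
  {H : Type*} [TopologicalSpace H] {J : ModelWithCorners ℝ E H}
  {M : Type*} [TopologicalSpace M] [ChartedSpace H M] [IsManifold J ∞ M] [T2Space M]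

open Literature.AlgebraicTopology.FundamentalGroup.VanKampen in
/-- **The complement of a thin compact set in a simply connected open set is simply connected**
(general position, Hirsch Ch. 3 Thm. 2.5: codimension `≥ 3` submanifolds do not obstruct paths
or null-homotopies). `C` compact, of interior points, covered by countably many `C¹` images of open
subsets of `ℝᵈ`, `d + 2 < dim E`; `U` open and simply connected; `U ∖ C ≠ ∅`.
[cite: HirschDT1976, Ch. 3 Thm. 2.5] -/
theorem IsSimplyConnected.diff_thin
    {ι : Type*} [Countable ι] {d : ℕ} (O : ι → Set (Fin d → ℝ)) (G : ι → (Fin d → ℝ) → M)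
    (hO : ∀ j, IsOpen (O j)) (hG : ∀ j, ContMDiffOn 𝓘(ℝ, Fin d → ℝ) J 1 (G j) (O j))
    (hdim : d + 2 < finrank ℝ E)
    {C : Set M} (hC : IsCompact C) (hCint : ∀ x ∈ C, J.IsInteriorPoint x)
    (hCG : C ⊆ ⋃ j, G j '' O j) {U : Set M} (hU : IsOpen U) (hsc : IsSimplyConnected U)
    (hne : (U \ C).Nonempty) : IsSimplyConnected (U \ C) := by
  rw [isSimplyConnected_iff_exists_homotopy_refl_forall_mem] at hsc ⊢
  obtain ⟨hUpc, hUloop⟩ := hsc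
  have hdim' : d + 1 < finrank ℝ E := by omega
  refine ⟨⟨hne.some, hne.some_mem, fun y hy => ?_⟩, fun x p hp => ?_⟩
  · -- paths: join in `U`, then push off `C`
    obtain ⟨γ, hγ⟩ := hUpc.joinedIn _ hne.some_mem.1 y hy.1
    obtain ⟨γ', hγ'C, hγ'⟩ := exists_path_forall_notMem_homotopicWithin O G hO hG hdim' hC hCint
      hCG hU γ hγ hne.some_mem.2 hy.2
    exact ⟨γ', fun t => ⟨hγ'.right_mem t, hγ'C t⟩⟩
  · -- loops: contract in `U`, then push the null-homotopy off `C`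
    obtain ⟨F, hF⟩ := hUloop x p fun t => (hp t).1
    obtain ⟨G', hG'⟩ := exists_homotopy_forall_notMem O G hO hG hdim hC hCint hCG hU p F
      (fun t => (hp t).2) hF
    exact ⟨G', fun st => ⟨(hG' st).1, (hG' st).2⟩⟩

end Literature.AlgebraicTopology.FundamentalGroupoid
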